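import Summits.HodgeConjecture.HodgeConjecture.Theorems.VHCAbelianSchemesRoadSecantQuotientMoverPolarization
import Summits.HodgeConjecture.HodgeConjecture.Theorems.VHCAbelianSchemesRoadIsogenyMovesPinnedTwistedData
import Summits.HodgeConjecture.HodgeConjecture.Theorems.VHCAbelianSchemesRoadSecantQuotientPinnedOwnChartDefs
import Summits.HodgeConjecture.HodgeConjecture.Theorems.VHCAbelianSchemesRoadSecantQuotientAnchorPinnedWeilPlane
import Summits.HodgeConjecture.HodgeConjecture.Theorems.VHCAbelianSchemesRoadSecantQuotientWeilPlaneMovedPair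
import HarnessLib

/-!
# Road №4 (`VHCAbelianSchemesRoad`) — CHILD (c3) «T → GRR → `SecondCarriedOfOffDiagonalVanishingPrime C`» OF CRUX stmt-HodgeConjecture-26512
# AS A KERNEL THEOREM MODULO THE TWO OWN-CHART NODES (P1) ∧ (P2) (p641318), with the Weil-plane direction algebra it needs
# (skeleton v3.9 `Cruxes/DiagLocalOfMarkmanPinnedForall/Lines/birth.lean` f1912d6f699b48a2, stub `stub_secondCarriedOfOffDiagonalVanishingPrime_of_T_GRR`)

research route conditional on HC_CM; not a corollary; Q11.4-sentence-2 already refuted in dim ≥ 3.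

THEOREMS ONLY (ring2-b03x gen 14, the ONE bounded prover seat of director-hodge g14 R14.14 on child (c3); `--supports stmt-HodgeConjecture-26512`;
fact-free, no definition, `HC_CM` nowhere). The registered child (c3) is `IsogenyPushforwardAdmissibilityTransferPrime → (∀ C, IsogenyPushforwardChernCharacter C)
→ ∀ C, SecondCarriedOfOffDiagonalVanishingPrime C` (p618714 §5: at a datum `D` with pin `h_Y(θ₀)`, a mover `g = ḡ_u`, `u = m + φ_d` off the three
degenerate directions, a pinned-served `γ₁` pinned by an `AdmTw′`-datum `𝓓` and (C^∨) for `(g, 𝓓.E)` ⟹ a SECOND pinned-served carried class `γ₂` with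
`𝔖^pin ⊆ ℂγ₁ + ℂγ₂ + ℂh_Y(θ₀)³`). VERDICT OF THIS SEAT: (c3) is a kernel theorem of T′ ∧ GRR MODULO EXACTLY the two `Prop`-nodes of
`…SecantQuotientPinnedOwnChartDefs` (p641318) — (P1) `SecantQuotientPinnedOwnChartClauses` (print-level: `D`'s own descended polarisation is on an ample
line and `(J × Ĵ, φ_d)` is hyperbolic for `Ξ_d(θ₀)`) and (P2) `SecantQuotientPinnedWeilPlaneRigidity` (in-house: a class pinned-served at `(D.Y.X, h_Y(θ₀))`
through ANY presentation has `q^*γ` in `D`'s own Weil plane) — and it is NOT derivable from T′ ∧ GRR alone: `γ ∈ 𝔖^pin(X, θ)` is existential in the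
presentation `(D', e, θ₀')`, the span clause of the target ranges over all of `𝔖^pin(D.Y.X, h_Y(θ₀))`, and T′ ∧ GRR are silent about other presentations
(the target's own conclusion implies (P2) modulo `ℂh³` wherever it applies). Everything else is PROVED here and in the two helper files p640467
(`…SecantQuotientMoverPolarization`: the mover scales the pin, `g^*h_Y(θ₀) = (m² + d)·h_Y(θ₀)`) and p640898 (`…IsogenyMovesPinnedTwistedData`: the moved datum
`IsogenyMovesPinnedTwistedData C Adm` from T ∧ GRR):

* the Weil-plane direction algebra (`(m + s)⁶ ≠ (m − s)⁶` off the degenerate directions, `u^* = (m ± s)⁶` on `E_±` for all `m : ℤ`, the real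
  structure, and «the moved pair spans `W`» — THEOREM M (a) in kernel form) is the third helper `…SecantQuotientWeilPlaneMovedPair`.
* §1 `secondCarriedOfOffDiagonalVanishing_of_movedData_of_ownChart : (P1) → (P2) → IsogenyMovesPinnedTwistedData C Adm → SecondCarriedOfOffDiagonalVanishing C Adm`
  (any door `Adm`): `γ₂ := γ'` with `g^*γ' = #Ker g(ℂ)·γ₁` (rational preimage, p640898 §1), carried by the moved datum (object `g_*𝓓.E`), `q^*γ' ∈ W`
  (`u^*(q^*γ') = q^*(g^*γ') = n·q^*γ₁`), pinned-served at the own chart by (P1) (`of_refl_of_ne_zero`), span by the moved-pair lemma with `z = 0` (`q^*` injective).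
  Under (P1) ∧ (P2) the pinned served set at an own chart IS the punctured rational Weil plane of `D` (`servedClassesPinned_eq_of_ownChart`).
* §2 **`secondCarriedOfOffDiagonalVanishingPrime_of_T_GRR_of_ownChart : (P1) → (P2) → [the registered (c3) statement VERBATIM]`.**

STUCK GOALS of the unconditional stub, verbatim: `⊢ SecantQuotientPinnedOwnChartClauses`, `⊢ SecantQuotientPinnedWeilPlaneRigidity`. NOT CLAIMED: (P1),
(P2), T, GRR, (C^∨), any stub, 2m′ᵒᴴ, 26512, 26511, 23176, `HC_AV`, `HC_CM` or HC; HC_CM HELD, by name only; typed ≠ proved.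
References: [cite: Markman2025SecantWeil, §1.3 (p. 5), Cor. 1.3.2, Thm. 1.4.1 (item 4), §1.5 (p. 7), Cor. 4.0.4, Lemma 8.3.1 and §9.3 Lemma 9.3.3–9.3.6, 9.3.11]
[cite: vanGeemen1994HodgeAV, §3.6, 4.8–4.9, Lemma 5.2 (5)–(6) and proof of Thm. 6.12] [cite: MoonenZarhin1998WeilClasses, §1 (dim_K W_K = 1)]
[cite: Deligne1982HodgeCycles, §4 (4.3)–Prop. 4.4] [cite: VoisinHodgeI2002, Cor. 6.12 and Thm. 11.23] [cite: MumfordAV1970, §19 Remark p. 169]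
[cite: BuchweitzFlenner2003, §5 Thm. 5.1] [cite: Bloch1972Semiregularity, Remark (7.5)] [cite: HatcherAT2002, §3.1–3.2].
-/

noncomputable section

open CategoryTheory CategoryTheory.Limits AlgebraicGeometry Topology

namespace Summit.HodgeConjecture.HodgeConjecture.Ring2.SemiregularRepresentatives

set_option linter.dupNamespace false -- the cell's namespace repeats the summit name, as in every `Ring2*` file

open Literature.AlgebraicGeometry Literature.AlgebraicGeometry.Motives Literature.AlgebraicGeometry.Motives.AbelianVariety
open Literature.AlgebraicGeometry.HodgeTheory Literature.AlgebraicGeometry.Markman2025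
open Literature.AlgebraicTopology.SingularHomology
open Summit.HodgeConjecture.HodgeConjecture.Ring2.AbelianAll (carriedClasses)

/-! ## §1 The signature from the moved datum and the two own-chart nodes -/

/-- **«(C_u^∨) ⇒ THE SECOND CARRIED CLASS» (`SecondCarriedOfOffDiagonalVanishing C Adm`, p618714 §5) FROM THE MOVED DATUM AND THE TWO
OWN-CHART NODES.** At `(D, θ₀, m, g = ḡ_u, γ₁, 𝓓)` with `γ₁` pinned-served and (C^∨): (P1) gives the anchor clauses of `D`'s own presentation,
(P2) puts `q^*γ₁` in `D`'s Weil plane `W`; the mover scales the pin (`g^*h_Y(θ₀) = (m² + d)·h_Y(θ₀)`, p640467); `γ'` with `g^*γ' = #Ker g·γ₁` is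
rational (`g^*` is a bijection of rational classes), and the MOVED DATUM (`IsogenyMovesPinnedTwistedData`, hypothesis `hMv`; a theorem of T ∧ GRR by
p640898) carries it with object `g_*𝓓.E`; `q^*γ' ∈ W` (`u^*(q^*γ') = #Ker g·q^*γ₁`, `u^*|_W` bijective), `γ' ≠ 0`, so `γ'` is pinned-served at the
own chart (`of_refl_of_ne_zero`); and every pinned-served `γ` has `q^*γ ∈ W = ℂq^*γ₁ + ℂq^*γ'` (moved-pair lemma), whence `γ = x·γ₁ + y·γ' + 0·h³` (`q^*`
injective). [cite: Markman2025SecantWeil, Thm. 1.4.1 (item 4), §1.3, §1.5 (p. 7) and §9.3 Lemma 9.3.11] [cite: vanGeemen1994HodgeAV, 4.9 and Lemma 5.2]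
[cite: MoonenZarhin1998WeilClasses, §1] [cite: Bloch1972Semiregularity, Remark (7.5)] -/
theorem secondCarriedOfOffDiagonalVanishing_of_movedData_of_ownChart {C : ChernCharacterBetti} {Adm : PerfectAdmissibility}
    (hP1 : SecantQuotientPinnedOwnChartClauses) (hP2 : SecantQuotientPinnedWeilPlaneRigidity)
    (hMv : IsogenyMovesPinnedTwistedData C Adm) : SecondCarriedOfOffDiagonalVanishing C Adm := by
  intro D θ₀ hθ₀ m g hg hm0 hm1 hm2 γ₁ 𝓓 hγ₁ hC
  have hS₁ : IsSecantQuotientWeilClassAtPinned D.Y.X (D.hY θ₀) γ₁ := hγ₁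
  obtain ⟨hamp, hhyp⟩ := hP1 D θ₀ hθ₀ ⟨γ₁, hS₁⟩
  have hW₁ : complexBetti.map D.q.hom.hom.hom (2 * 3) γ₁ ∈ weilClassesOf D.P D.ψ 3 D.d := hP2 D θ₀ hθ₀ γ₁ hγ₁
  have hpol : IsPolarizationClass 6 D.Y.X (D.hY θ₀) := hS₁.isPolarizationClass
  have hγ₁Q : IsRationalClass γ₁ := hS₁.isRationalClass
  have hγ₁0 : γ₁ ≠ 0 := hS₁.ne_zero
  have hgι : IsIsogeny g := hg.isIsogeny
  -- the mover scales the pin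
  have hgθ : complexBetti.map g.hom.hom.hom 2 (D.hY θ₀) = ((m : ℂ) ^ 2 + D.d) • D.hY θ₀ := hg.complexBetti_map_hY θ₀
  -- `#Ker g(ℂ) ≠ 0`
  haveI : IsFinite (Hom.toSchemeHom g) := hgι.2
  haveI : Finite (Hom.kerPoints (specOver ℂ ℂ) g) := finite_kerPoints_of_isFinite g ℂ
  have hn : ((Nat.card (Hom.kerPoints (specOver ℂ ℂ) g) : ℕ) : ℂ) ≠ 0 := Nat.cast_ne_zero.2 Nat.card_pos.ne'
  -- `γ'` rational with `g^*γ' = n·γ₁`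
  have hnγ₁Q : IsRationalClass (((Nat.card (Hom.kerPoints (specOver ℂ ℂ) g) : ℕ) : ℂ) • γ₁) := by
    have h := hγ₁Q.smul (Nat.card (Hom.kerPoints (specOver ℂ ℂ) g) : ℚ)
    rwa [Rat.cast_natCast] at h
  obtain ⟨γ', hγ'Q, hgγ'⟩ := exists_rational_preimage_of_isIsogeny hgι hnγ₁Q
  -- the moved datum carries `γ'`
  obtain ⟨𝓓', -, -⟩ := hMv D.Y D.dim_Y g hgι (D.hY θ₀) _ hgθ γ₁ 𝓓 hC γ' hgγ'
  have hγ'0 : γ' ≠ 0 := by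
    intro h0
    rw [h0, map_zero] at hgγ'
    exact smul_ne_zero hn hγ₁0 hgγ'.symm
  -- `q^*γ'` lies in the Weil plane: `u^*(q^*γ') = q^*(g^*γ') = n·q^*γ₁ ∈ W`
  have hu : complexBetti.map (D.weilEndo m).hom.hom.hom (2 * 3) (complexBetti.map D.q.hom.hom.hom (2 * 3) γ') =
      ((Nat.card (Hom.kerPoints (specOver ℂ ℂ) g) : ℕ) : ℂ) • complexBetti.map D.q.hom.hom.hom (2 * 3) γ₁ := by
    rw [← D.complexBetti_map_q_map_of_intertwiner hg.q_comp, hgγ', map_smul]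
  have hW₁0 : complexBetti.map D.q.hom.hom.hom (2 * 3) γ₁ ≠ 0 := fun h0 =>
    hγ₁0 ((D.complexBetti_map_q_bijective (2 * 3)).1 (by rw [h0, map_zero]))
  obtain ⟨hW', hspan⟩ := D.mem_weilClassesOf_and_span_of_map_weilEndo_eq_smul hm0 hm1 hm2 hW₁ (hγ₁Q.map _) hW₁0 hn hu
  have hγ'S : γ' ∈ secantQuotientServedClassesPinned D.Y.X (D.hY θ₀) :=
    IsSecantQuotientWeilClassAtPinned.of_refl_of_ne_zero D hθ₀ hpol hamp hhyp hγ'Q hγ'0 hW'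
  refine ⟨γ', hγ'S, 𝓓'.mem_carriedClasses, fun γ hγ => ?_⟩
  obtain ⟨x, y, hxy⟩ := hspan _ (hP2 D θ₀ hθ₀ γ hγ)
  refine ⟨x, y, 0, ?_⟩
  apply (D.complexBetti_map_q_bijective (2 * 3)).1
  rw [hxy, zero_smul, add_zero, map_add, map_smul, map_smul]

/-- **The primed instance keyed to the children of crux stmt-HodgeConjecture-26512**: `SecondCarriedOfOffDiagonalVanishingPrime C` from (P1), (P2) and
the moved datum at `AdmTw′`. [cite: Markman2025SecantWeil, Thm. 1.4.1 (item 4) and §9.3 Lemma 9.3.11] [cite: BuchweitzFlenner2003, §5 Thm. 5.1] -/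
theorem secondCarriedOfOffDiagonalVanishingPrime_of_movedData_of_ownChart {C : ChernCharacterBetti}
    (hP1 : SecantQuotientPinnedOwnChartClauses) (hP2 : SecantQuotientPinnedWeilPlaneRigidity)
    (hMv : IsogenyMovesPinnedTwistedData C
      (fun n X₀ I E => Summit.Ventures.HSemireg.gluableSigmaAdmissible n X₀ I E ∨
        Literature.AlgebraicGeometry.HodgeTheory.bfSingleAdmissible' n X₀ I E)) :
    SecondCarriedOfOffDiagonalVanishingPrime C :=
  secondCarriedOfOffDiagonalVanishing_of_movedData_of_ownChart hP1 hP2 hMv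

/-- **UNDER (P1) ∧ (P2) THE PINNED SERVED SET AT AN OWN CHART IS THE PUNCTURED RATIONAL WEIL PLANE OF THE DATUM**: at `(D.Y.X, h_Y(θ₀))`, `θ₀` a
polarisation class of `Θ`, once SOME class is pinned-served there, `γ ∈ 𝔖^pin ⟺ γ ≠ 0 ∧ γ rational ∧ q^*γ ∈ weilClassesOf D.P D.ψ 3 D.d` — `⊇` is the
tree's `IsSecantQuotientWeilClassAtPinned.of_refl_of_ne_zero` fed by (P1), `⊆` is (P2) with `IsSecantQuotientWeilClassAtPinned.ne_zero ∕ .isRationalClass`.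
This is the exact content the two nodes add to the road's anchor data `(𝔄^pin, 𝔖^pin)`. [cite: Markman2025SecantWeil, Thm. 1.4.1 (item 4) and §1.5 (p. 7)]
[cite: vanGeemen1994HodgeAV, 4.9 and Lemma 5.2] -/
theorem servedClassesPinned_eq_of_ownChart (hP1 : SecantQuotientPinnedOwnChartClauses) (hP2 : SecantQuotientPinnedWeilPlaneRigidity)
    (D : SecantQuotientDatum) {θ₀ : complexBetti D.𝒥.J.X 2} (hθ₀ : D.𝒥.J.IsPolarizationClassOf D.Θ θ₀)
    (hA : secantQuotientAnchorsPinned D.Y.X (D.hY θ₀)) :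
    secantQuotientServedClassesPinned D.Y.X (D.hY θ₀) =
      {γ : complexBetti D.Y.X (2 * 3) | γ ≠ 0 ∧ IsRationalClass γ ∧
        complexBetti.map D.q.hom.hom.hom (2 * 3) γ ∈ weilClassesOf D.P D.ψ 3 D.d} := by
  obtain ⟨γ₀, hγ₀⟩ := hA
  have hS₀ : IsSecantQuotientWeilClassAtPinned D.Y.X (D.hY θ₀) γ₀ := hγ₀
  obtain ⟨hamp, hhyp⟩ := hP1 D θ₀ hθ₀ ⟨γ₀, hS₀⟩
  refine Set.Subset.antisymm (fun γ hγ => ?_)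
    (D.setOf_ne_zero_rational_weil_subset_servedClassesPinned hθ₀ hS₀.isPolarizationClass hamp hhyp)
  have hS : IsSecantQuotientWeilClassAtPinned D.Y.X (D.hY θ₀) γ := hγ
  exact ⟨hS.ne_zero, hS.isRationalClass, hP2 D θ₀ hθ₀ γ hγ⟩

/-! ## §2 CHILD (c3) BY NAME, CONDITIONAL ON (P1) ∧ (P2) -/

/-- **CHILD (c3) OF CRUX stmt-HodgeConjecture-26512 AS A KERNEL THEOREM MODULO (P1) ∧ (P2)**: the registered stub
`stub_secondCarriedOfOffDiagonalVanishingPrime_of_T_GRR : IsogenyPushforwardAdmissibilityTransferPrime → (∀ C, IsogenyPushforwardChernCharacter C) →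
∀ C, SecondCarriedOfOffDiagonalVanishingPrime C` (skeleton v3.9 f1912d6f699b48a2), with its statement VERBATIM as conclusion and the two own-chart
nodes as displayed hypotheses: THEOREM T′ ∧ GRR give the moved datum (p640898 `isogenyMovesPinnedTwistedData_of_transfer_of_chernCharacter`), §3 does
the rest. Stuck goals of the unconditional stub: `⊢ SecantQuotientPinnedOwnChartClauses`, `⊢ SecantQuotientPinnedWeilPlaneRigidity` (companion
Defs file). Hypothesis form; nothing asserted. [cite: Markman2025SecantWeil, Thm. 1.4.1 (item 4), §1.3, §1.5 (p. 7) and §9.3 Lemma 9.3.11]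
[cite: vanGeemen1994HodgeAV, 4.9 and Lemma 5.2] [cite: MoonenZarhin1998WeilClasses, §1] [cite: BuchweitzFlenner2003, §5 Thm. 5.1]
[cite: Bloch1972Semiregularity, Remark (7.5)] -/
theorem secondCarriedOfOffDiagonalVanishingPrime_of_T_GRR_of_ownChart
    (hP1 : SecantQuotientPinnedOwnChartClauses) (hP2 : SecantQuotientPinnedWeilPlaneRigidity) :
    IsogenyPushforwardAdmissibilityTransferPrime → (∀ C : ChernCharacterBetti, IsogenyPushforwardChernCharacter C) →
      ∀ C : ChernCharacterBetti, SecondCarriedOfOffDiagonalVanishingPrime C :=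
  fun hT hG C => secondCarriedOfOffDiagonalVanishingPrime_of_movedData_of_ownChart hP1 hP2
    (isogenyMovesPinnedTwistedData_prime_of_transfer_of_chernCharacter hT (hG C))

#print axioms secondCarriedOfOffDiagonalVanishingPrime_of_T_GRR_of_ownChart

/-! ## §3 POINTWISE form (appended): the second carried class at ONE datum from that datum's own-chart clauses and its own rigidity -/

/-- **THE SECOND CARRIED CLASS AT ONE DATUM, FROM POINTWISE INPUTS** — the proof of §1 with the two global nodes replaced by their instances AT
THE DATUM: the own-chart anchor clauses `hamp`, `hhyp` of `D` at `θ₀` (at a non-hyperelliptic H-good datum these are OUTPUTS of the displayed print input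
L1″_∀, cf. `exists_carried_pinned_of_presentedOffHypDisj_of_pinnedForall` ∕ `PinnedTwistedDatum.nonempty_of_pinnedForall`, so inside the skeleton — where
`hL` is in scope — (P1) costs nothing on the line's anchor family) and Weil-plane rigidity AT `(D, θ₀)` only (`hrig`: every class pinned-served at
`(D.Y.X, h_Y(θ₀))` has `q^*γ ∈ W(D)` — the instance of (P2) the conclusion's span clause needs anyway). For the LEAD: this is the glue a re-typed signature
«L1″_∀(C, Adm) → rigidity at the datum → T → GRR → second carried class» would call. [cite: Markman2025SecantWeil, Thm. 1.4.1 (item 4), §1.5 (p. 7) and §9.3 Lemma 9.3.11]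
[cite: vanGeemen1994HodgeAV, 4.9 and Lemma 5.2] [cite: MoonenZarhin1998WeilClasses, §1] [cite: Bloch1972Semiregularity, Remark (7.5)] -/
theorem SecantQuotientDatum.exists_secondCarried_of_movedData_at {C : ChernCharacterBetti} {Adm : PerfectAdmissibility}
    (hMv : IsogenyMovesPinnedTwistedData C Adm) (D : SecantQuotientDatum) {θ₀ : complexBetti D.𝒥.J.X 2}
    (hθ₀ : D.𝒥.J.IsPolarizationClassOf D.Θ θ₀)
    (hamp : ∃ H : CartierDivisor D.Y.X.left, H.IsAmple ∧ D.Y.IsPolarizationClassOf H (D.hY θ₀))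
    (hhyp : IsHyperbolicWeilType D.P D.ψ 3 (complexBetti.map D.q.hom.hom.hom 2 (D.hY θ₀)))
    (hrig : ∀ γ ∈ secantQuotientServedClassesPinned D.Y.X (D.hY θ₀), complexBetti.map D.q.hom.hom.hom (2 * 3) γ ∈ weilClassesOf D.P D.ψ 3 D.d)
    {m : ℤ} {g : D.Y ⟶ D.Y} (hg : D.IsMover m g) (hm0 : m ≠ 0) (hm1 : 3 * m ^ 2 ≠ (D.d : ℤ)) (hm2 : m ^ 2 ≠ 3 * (D.d : ℤ))
    {γ₁ : complexBetti D.Y.X (2 * 3)} (𝓓 : PinnedTwistedDatum C Adm D.Y.X (D.hY θ₀) γ₁)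
    (hγ₁ : γ₁ ∈ secantQuotientServedClassesPinned D.Y.X (D.hY θ₀)) (hC : OffDiagonalExtVanishing D.Y g 𝓓.E) :
    ∃ γ₂ ∈ secantQuotientServedClassesPinned D.Y.X (D.hY θ₀),
      γ₂ ∈ carriedClasses (twistedReflexiveClass C Adm) 6 3 D.Y.X (D.hY θ₀) ∧
      ∀ γ ∈ secantQuotientServedClassesPinned D.Y.X (D.hY θ₀), ∃ x y z : ℂ, γ = x • γ₁ + y • γ₂ + z • cupPowTwo (D.hY θ₀) 3 := by
  have hS₁ : IsSecantQuotientWeilClassAtPinned D.Y.X (D.hY θ₀) γ₁ := hγ₁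
  have hW₁ : complexBetti.map D.q.hom.hom.hom (2 * 3) γ₁ ∈ weilClassesOf D.P D.ψ 3 D.d := hrig γ₁ hγ₁
  have hpol : IsPolarizationClass 6 D.Y.X (D.hY θ₀) := hS₁.isPolarizationClass
  have hγ₁Q : IsRationalClass γ₁ := hS₁.isRationalClass
  have hγ₁0 : γ₁ ≠ 0 := hS₁.ne_zero
  have hgι : IsIsogeny g := hg.isIsogeny
  have hgθ : complexBetti.map g.hom.hom.hom 2 (D.hY θ₀) = ((m : ℂ) ^ 2 + D.d) • D.hY θ₀ := hg.complexBetti_map_hY θ₀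
  haveI : IsFinite (Hom.toSchemeHom g) := hgι.2
  haveI : Finite (Hom.kerPoints (specOver ℂ ℂ) g) := finite_kerPoints_of_isFinite g ℂ
  have hn : ((Nat.card (Hom.kerPoints (specOver ℂ ℂ) g) : ℕ) : ℂ) ≠ 0 := Nat.cast_ne_zero.2 Nat.card_pos.ne'
  have hnγ₁Q : IsRationalClass (((Nat.card (Hom.kerPoints (specOver ℂ ℂ) g) : ℕ) : ℂ) • γ₁) := by
    have h := hγ₁Q.smul (Nat.card (Hom.kerPoints (specOver ℂ ℂ) g) : ℚ)
    rwa [Rat.cast_natCast] at h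
  obtain ⟨γ', hγ'Q, hgγ'⟩ := exists_rational_preimage_of_isIsogeny hgι hnγ₁Q
  obtain ⟨𝓓', -, -⟩ := hMv D.Y D.dim_Y g hgι (D.hY θ₀) _ hgθ γ₁ 𝓓 hC γ' hgγ'
  have hγ'0 : γ' ≠ 0 := by
    intro h0
    rw [h0, map_zero] at hgγ'
    exact smul_ne_zero hn hγ₁0 hgγ'.symm
  have hu : complexBetti.map (D.weilEndo m).hom.hom.hom (2 * 3) (complexBetti.map D.q.hom.hom.hom (2 * 3) γ') =
      ((Nat.card (Hom.kerPoints (specOver ℂ ℂ) g) : ℕ) : ℂ) • complexBetti.map D.q.hom.hom.hom (2 * 3) γ₁ := by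
    rw [← D.complexBetti_map_q_map_of_intertwiner hg.q_comp, hgγ', map_smul]
  have hW₁0 : complexBetti.map D.q.hom.hom.hom (2 * 3) γ₁ ≠ 0 := fun h0 =>
    hγ₁0 ((D.complexBetti_map_q_bijective (2 * 3)).1 (by rw [h0, map_zero]))
  obtain ⟨hW', hspan⟩ := D.mem_weilClassesOf_and_span_of_map_weilEndo_eq_smul hm0 hm1 hm2 hW₁ (hγ₁Q.map _) hW₁0 hn hu
  have hγ'S : γ' ∈ secantQuotientServedClassesPinned D.Y.X (D.hY θ₀) :=
    IsSecantQuotientWeilClassAtPinned.of_refl_of_ne_zero D hθ₀ hpol hamp hhyp hγ'Q hγ'0 hW'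
  refine ⟨γ', hγ'S, 𝓓'.mem_carriedClasses, fun γ hγ => ?_⟩
  obtain ⟨x, y, hxy⟩ := hspan _ (hrig γ hγ)
  refine ⟨x, y, 0, ?_⟩
  apply (D.complexBetti_map_q_bijective (2 * 3)).1
  rw [hxy, zero_smul, add_zero, map_add, map_smul, map_smul]

/-- **AT A NON-HYPERELLIPTIC H-GOOD DATUM THE OWN-CHART CLAUSES COME FROM THE DISPLAYED PRINT INPUT**: L1″_∀ (`Markman2025_secantQuotient_twistedCarrier_onJacobian_pinnedForall
C Adm`, hypothesis form) at `(D, θ₀)` with `¬ D.𝒥.IsHyperelliptic`, `OrbitTranslatesDisjoint` and `θ₀` a polarisation class YIELDS `hamp` and `hhyp` for `D` itself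
(they are clauses of `IsTwistedCarrierWeilPairOn`) — so on the line's anchor family node (P1) is free modulo item 26511, and only the rigidity (P2) remains.
[cite: Markman2025SecantWeil, Thm. 1.4.1 (item 4), §1.5 (p. 7), §3.1 Lemma 3.1.3 and §3.2 Cor. 3.2.3] -/
theorem SecantQuotientDatum.ownChartClauses_of_pinnedForall {C : ChernCharacterBetti} {Adm : PerfectAdmissibility}
    (hLC : Markman2025_secantQuotient_twistedCarrier_onJacobian_pinnedForall C Adm) (D : SecantQuotientDatum) {θ₀ : complexBetti D.𝒥.J.X 2}
    (hnh : ¬ D.𝒥.IsHyperelliptic) (hH : OrbitTranslatesDisjoint D.𝒥 D.G₁ D.G₂) (hθ₀ : D.𝒥.J.IsPolarizationClassOf D.Θ θ₀) :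
    (∃ H : CartierDivisor D.Y.X.left, H.IsAmple ∧ D.Y.IsPolarizationClassOf H (D.hY θ₀)) ∧
      IsHyperbolicWeilType D.P D.ψ 3 (complexBetti.map D.q.hom.hom.hom 2 (D.hY θ₀)) := by
  have hD : ∃ γ : complexBetti D.Y.X (2 * 3), IsTwistedCarrierWeilPairOn C Adm D.𝒥.J D.isAmple D.KTheta_eq_bot D.G₁ D.G₂
      D.succ_ne_zero D.G₁_le D.G₂_le D.d (D.hY θ₀) γ :=
    hLC D.d D.even D.four_le D.C D.smooth D.𝒥 D.dim_J D.Θ D.riemann D.principal D.G₁ D.G₂ D.G₁_le D.G₂_le hnh hH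
      D.cyclic₁ D.card₁ D.cyclic₂ D.card₂ D.disjoint D.generalPosition θ₀ hθ₀
  obtain ⟨γ, -, hamp, hhyp, -⟩ := hD
  exact ⟨hamp, hhyp⟩

/-- **2m′ᵒᴴ-SHAPED COROLLARY ON THE LINE'S ANCHOR FAMILY, (P1)-FREE**: given L1″_∀(C, Adm) (hypothesis form = item 26511 at `Adm = AdmTw′`), the moved datum (a
theorem of T ∧ GRR, p640898) and Weil-plane rigidity AT the datum, every non-hyperelliptic H-good datum with a pinned-served `γ₁` pinned by an `Adm`-datum `𝓓`
and a mover with (C^∨) for `𝓓.E` has the second carried class with the span. This is what a v3.10 re-typing of the signature with `hL` threaded would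
consume; the residue of (c3) on the line's own anchor family is then (P2) alone. [cite: Markman2025SecantWeil, Thm. 1.4.1 (item 4), §1.5 (p. 7) and §9.3 Lemma 9.3.11]
[cite: MoonenZarhin1998WeilClasses, §1] [cite: Bloch1972Semiregularity, Remark (7.5)] -/
theorem SecantQuotientDatum.exists_secondCarried_of_pinnedForall_of_movedData_at {C : ChernCharacterBetti} {Adm : PerfectAdmissibility}
    (hLC : Markman2025_secantQuotient_twistedCarrier_onJacobian_pinnedForall C Adm) (hMv : IsogenyMovesPinnedTwistedData C Adm)
    (D : SecantQuotientDatum) {θ₀ : complexBetti D.𝒥.J.X 2} (hnh : ¬ D.𝒥.IsHyperelliptic) (hH : OrbitTranslatesDisjoint D.𝒥 D.G₁ D.G₂)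
    (hθ₀ : D.𝒥.J.IsPolarizationClassOf D.Θ θ₀)
    (hrig : ∀ γ ∈ secantQuotientServedClassesPinned D.Y.X (D.hY θ₀), complexBetti.map D.q.hom.hom.hom (2 * 3) γ ∈ weilClassesOf D.P D.ψ 3 D.d)
    {m : ℤ} {g : D.Y ⟶ D.Y} (hg : D.IsMover m g) (hm0 : m ≠ 0) (hm1 : 3 * m ^ 2 ≠ (D.d : ℤ)) (hm2 : m ^ 2 ≠ 3 * (D.d : ℤ))
    {γ₁ : complexBetti D.Y.X (2 * 3)} (𝓓 : PinnedTwistedDatum C Adm D.Y.X (D.hY θ₀) γ₁)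
    (hγ₁ : γ₁ ∈ secantQuotientServedClassesPinned D.Y.X (D.hY θ₀)) (hC : OffDiagonalExtVanishing D.Y g 𝓓.E) :
    ∃ γ₂ ∈ secantQuotientServedClassesPinned D.Y.X (D.hY θ₀),
      γ₂ ∈ carriedClasses (twistedReflexiveClass C Adm) 6 3 D.Y.X (D.hY θ₀) ∧
      ∀ γ ∈ secantQuotientServedClassesPinned D.Y.X (D.hY θ₀), ∃ x y z : ℂ, γ = x • γ₁ + y • γ₂ + z • cupPowTwo (D.hY θ₀) 3 := by
  obtain ⟨hamp, hhyp⟩ := D.ownChartClauses_of_pinnedForall hLC hnh hH hθ₀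
  exact D.exists_secondCarried_of_movedData_at hMv hθ₀ hamp hhyp hrig hg hm0 hm1 hm2 𝓓 hγ₁ hC


end Summit.HodgeConjecture.HodgeConjecture.Ring2.SemiregularRepresentatives

end
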